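import Summits.CriticalPhenomena.PercolationContinuityZ3.Theorems.SahiMasterFamilyGluedFramesTwoPure

/-!
# The local-to-global step at order four (THEOREM LG4), I: type-one annihilator points

Unit `prim-master-conj` (crux anchor stmt-CriticalPhenomena-4575), gen 11; memo HOME/prim-master-conj/TIGHTNESS-III.md §2.5–§2.6.
Setting (`SahiMasterFamilyGluedFrames*`): a family `U` of non-empty, non-sure increasing events on `W = univ`, structured contraction faces,
glued frames with pairwise disjoint supports, structured and consistent deletion faces at core-free coordinates, a core-free coordinate.
For two PURE members `a, b` and two NON-pure members `v, w`:
* `two_le_card_gfail'` — (F2) at every point of a glued annihilator (contraction face if the point is non-empty, a deletion face otherwise);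
* `TypeOne U W v w p q χ` — `χ` is a TYPE-ONE point of `v`: in the glued annihilator of `v`, outside the glued frame of `w`, outside the pure
  member `p`, inside the pure member `q`;
* **`exists_typeOne_of_not_structured`** (TIGHTNESS-III 2.5, (O′)): if `{a, b, v}` is not structured then `v` has a type-one point (w.r.t. `w`)
  — the sandwich direction `structured_insert_of_pairwise_disjoint` + (F2);
* **`typeOne_antipodal`** (2.6): type-one points `χ` of `v` and `ψ` of `w` share no coordinate and together contain every core-free coordinate;
* **`typeOne_diff_singleton`** (2.6 (ii)): removing from a type-one point `χ` of `v` a core-free coordinate lying in ANOTHER type-one point's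
  complement… precisely: if `f ∈ χ` is core-free and some type-one point of `w` exists, then `χ ∖ {f}` leaves `gframe v ∩ U q`.
Auxiliary: `mem_of_union_mem_of_disjoint_esupp`, `exists_step_of_union_mem` (a walk lemma), `disjoint_esupp_of_structured_pair`,
`mem_iff_esupp_subset_of_verts_eq_empty` (an increasing event without vertices is principal on its support).  Axioms standard. [this work]
-/

noncomputable section

open scoped Classical

namespace Summit.CriticalPhenomena.PercolationContinuityZ3.Theorems

namespace GluedFrames

open Finset Function
open Literature.Probability.LatticeModels.Kahn2022 (Affects)

variable {ι : Type*} [Fintype ι] {κ : Type*}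

/-! ### Auxiliary lemmas on increasing events -/

section Aux

/-- Turning on coordinates outside the essential support does not matter. [folklore] -/
theorem mem_of_union_mem_of_disjoint_esupp {A : Set (Set ι)} (hA : IsUpperSet A) {S : Set ι} (hS : Disjoint S ↑(esupp A))
    {ω : Set ι} (h : ω ∪ S ∈ A) : ω ∈ A := by
  have := hull_eq_self_of_disjoint hA hS
  rw [← this, mem_hull]; exact h

omit [Fintype ι] in
/-- Removing a non-affecting coordinate does not matter. [folklore] -/
theorem diff_singleton_mem_of_not_affects {A : Set (Set ι)} (hA : IsUpperSet A) {f : ι} (hf : ¬ Affects A f) {ω : Set ι}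
    (h : ω ∈ A) : ω \ {f} ∈ A := by
  refine (insert_mem_iff_of_not_affects hA hf (ω \ {f})).1 ?_
  rw [Set.insert_sdiff_singleton]; exact hA (Set.subset_insert f ω) h

/-- A configuration disjoint from the essential support of a non-sure increasing event is outside it. [folklore] -/
theorem not_mem_of_disjoint_esupp {A : Set (Set ι)} (hA : IsUpperSet A) (hAu : A ≠ Set.univ) {ω : Set ι}
    (h : Disjoint ω ↑(esupp A)) : ω ∉ A := by
  intro hω
  apply hAu
  refine Set.eq_univ_of_forall fun ω' => hA (Set.empty_subset ω') ?_
  refine (mem_iff_of_inter_esupp_eq hA (ω := ∅) (ω' := ω) ?_).2 hω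
  rw [Set.empty_inter, Set.disjoint_iff_inter_eq_empty.1 h]

omit [Fintype ι] in
/-- **Walk lemma**: if `μ ∉ A` but `μ ∪ D ∈ A` for a finite set `D` of coordinates, some single coordinate of `D` switches membership along the
way: `μ ∪ T ∉ A`, `insert g (μ ∪ T) ∈ A` with `T ⊆ D`, `g ∈ D`. [folklore] -/
theorem exists_step_of_union_mem {A : Set (Set ι)} {μ : Set ι} (hμ : μ ∉ A) :
    ∀ (D : Finset ι), μ ∪ ↑D ∈ A → ∃ T : Finset ι, T ⊆ D ∧ ∃ g ∈ D, μ ∪ ↑T ∉ A ∧ insert g (μ ∪ ↑T) ∈ A := by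
  intro D
  induction D using Finset.induction with
  | empty => intro h; simp at h; exact absurd h hμ
  | @insert g D' hgD ih =>
    intro h
    by_cases h' : μ ∪ ↑D' ∈ A
    · obtain ⟨T, hTD, g', hg', h1, h2⟩ := ih h'
      exact ⟨T, hTD.trans (subset_insert g D'), g', mem_insert_of_mem hg', h1, h2⟩
    · refine ⟨D', subset_insert g D', g, mem_insert_self g D', h', ?_⟩
      have e : insert g (μ ∪ ↑D') = μ ∪ ↑(insert g D') := by
        rw [coe_insert, Set.union_insert]
      rw [e]; exact h

/-- A structured pair has disjoint essential supports. [this work] -/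
theorem disjoint_esupp_of_structured_pair (Φ : κ → Set (Set ι)) (hΦ : ∀ k, IsUpperSet (Φ k)) {x y : κ} (hxy : x ≠ y)
    (h : Structured Φ ({x, y} : Finset κ)) : Disjoint (esupp (Φ x)) (esupp (Φ y)) := by
  obtain ⟨l, hlW, hn, hlen, hl⟩ := Structured.exists_chain Φ h
  rw [card_pair hxy] at hlen
  obtain ⟨c, d, rfl⟩ := List.length_eq_two.1 hlen
  have hcd : c ≠ d := fun e => (List.nodup_cons.1 hn).1 (e ▸ List.mem_singleton.2 rfl)
  have hmem : ∀ z, z ∈ ({x, y} : Finset κ) ↔ z = c ∨ z = d := by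
    intro z; rw [← hlW]; simp
  have hdis := (goodChain_pair_iff Φ hΦ hcd).1 hl
  rcases (hmem x).1 (by simp) with rfl | rfl
  · rcases (hmem y).1 (by simp) with h1 | rfl
    · exact absurd h1.symm hxy
    · exact hdis
  · rcases (hmem y).1 (by simp) with rfl | h1
    · exact hdis.symm
    · exact absurd h1.symm hxy

/-- **An increasing event without vertices is principal on its essential support.** [this work] -/
theorem mem_iff_esupp_subset_of_verts_eq_empty {A : Set (Set ι)} (hA : IsUpperSet A) (hne : A.Nonempty) (hV : verts A = ∅)
    (ω : Set ι) : ω ∈ A ↔ ↑(esupp A) ⊆ ω := by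
  constructor
  · intro hω c hc
    by_contra hcω
    exact not_mem_of_not_mem_of_not_vert hA (mem_coe.1 hc) (by rw [hV]; exact notMem_empty c) hcω hω
  · intro hsub
    refine (mem_iff_of_inter_esupp_eq hA (ω := ω) (ω' := Set.univ) ?_).2 (univ_mem_of_nonempty hA hne)
    rw [Set.univ_inter, Set.inter_eq_right.2 hsub]

/-- A finite set with at least two elements, all among `x, y, z`, and not containing `x`, contains `y` and `z`. [folklore] -/
theorem mem_and_mem_of_two_le_card {S : Finset κ} (h2 : 2 ≤ S.card) {x y z : κ} (hS : ∀ u ∈ S, u = x ∨ u = y ∨ u = z) (hx : x ∉ S) :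
    y ∈ S ∧ z ∈ S := by
  have hsub : S ⊆ {y, z} := by
    intro u hu
    rcases hS u hu with rfl | rfl | rfl
    · exact absurd hu hx
    · simp
    · simp
  by_contra hnot
  rw [not_and_or] at hnot
  rcases hnot with hy | hz
  · have : S ⊆ {z} := fun u hu => by
      have := hsub hu; rw [mem_insert, mem_singleton] at this
      rcases this with rfl | rfl
      · exact absurd hu hy
      · simp
    have := (card_le_card this).trans (card_singleton z).le
    omega
  · have : S ⊆ {y} := fun u hu => by
      have := hsub hu; rw [mem_insert, mem_singleton] at this
      rcases this with rfl | rfl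
      · simp
      · exact absurd hu hz
    have := (card_le_card this).trans (card_singleton y).le
    omega

end Aux

/-! ### (F2) everywhere -/

section Glued

variable (U : κ → Set (Set ι)) (W : Finset κ)

/-- **(F2) at every point**: a configuration of the glued annihilator of `w` fails the glued frames of at least two other members — via a
contraction face if it is non-empty, via the deletion face at a core-free coordinate otherwise. [this work] -/
theorem two_le_card_gfail' (hU : ∀ k, IsUpperSet (U k)) (hne : ∀ k, (U k).Nonempty) (hS : ∀ h, Structured (faceT U h) W)
    (hF : ∀ f, CoreFree U f → Structured (faceF U f) W ∧ FaceFConsistent U W f) (hE0 : ∃ f, CoreFree U f)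
    {w : κ} (hw : w ∈ W) {χ : Set ι} (hχ : χ ∈ gann U W w) : 2 ≤ ((W.erase w).filter fun j => χ ∉ gframe U W j).card := by
  rcases Set.eq_empty_or_nonempty χ with h | h
  · obtain ⟨f, hf⟩ := hE0
    subst h
    exact two_le_card_gfail_of_faceF U W hU hf (hF f hf).1 (hF f hf).2 hw hχ (Set.notMem_empty f)
  · exact two_le_card_gfail U W hU hne hS hw hχ h

/-! ### Type-one points -/

/-- **Type-one point** `χ` of `v` (relative to the other non-pure member `w`, the failed pure member `p` and the host pure member `q`). [this work] -/
def TypeOne (v w p q : κ) (χ : Set ι) : Prop := χ ∈ gann U W v ∧ χ ∉ gframe U W w ∧ χ ∉ U p ∧ χ ∈ U q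

/-- **(O′), TIGHTNESS-III 2.5.**  Members `a, b` pure, `v ∉ {a, b}`, `w` a further member with `W ∖ v ⊆ {a, b, w}`.  If `{a, b} + v` is NOT
structured then `v` has a type-one point relative to `w`, failing exactly one of `a, b`. [this work] -/
theorem exists_typeOne_of_not_structured (hU : ∀ k, IsUpperSet (U k)) (hne : ∀ k, (U k).Nonempty)
    (hS : ∀ h, Structured (faceT U h) W)
    (hd : ∀ w ∈ W, ∀ w' ∈ W, w ≠ w' → Disjoint (esupp (gframe U W w)) (esupp (gframe U W w')))
    (hF : ∀ f, CoreFree U f → Structured (faceF U f) W ∧ FaceFConsistent U W f) (hE0 : ∃ f, CoreFree U f)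
    {a b v w : κ} (ha : a ∈ W) (hb : b ∈ W) (hv : v ∈ W) (hab : a ≠ b) (hav : a ≠ v) (hbv : b ≠ v)
    (hrest : ∀ u ∈ W, u ≠ v → u = a ∨ u = b ∨ u = w)
    (hpa : gann U W a = ∅) (hpb : gann U W b = ∅) (hns : ¬ Structured U (insert v ({a, b} : Finset κ))) :
    ∃ χ, TypeOne U W v w a b χ ∨ TypeOne U W v w b a χ := by
  have hga : gframe U W a = U a := (gann_eq_empty_iff U W hU a).1 hpa
  have hgb : gframe U W b = U b := (gann_eq_empty_iff U W hU b).1 hpb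
  have hvP : v ∉ ({a, b} : Finset κ) := by simp [hav.symm, hbv.symm]
  have hdP : ∀ x ∈ ({a, b} : Finset κ), ∀ x' ∈ ({a, b} : Finset κ), x ≠ x' → Disjoint (esupp (U x)) (esupp (U x')) := by
    intro x hx x' hx' hxx'
    simp only [mem_insert, mem_singleton] at hx hx'
    have hxW : x ∈ W := by rcases hx with rfl | rfl <;> assumption
    have hx'W : x' ∈ W := by rcases hx' with rfl | rfl <;> assumption
    have e1 : gframe U W x = U x := by rcases hx with rfl | rfl <;> assumption
    have e2 : gframe U W x' = U x' := by rcases hx' with rfl | rfl <;> assumption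
    have := hd x hxW x' hx'W hxx'
    rwa [e1, e2] at this
  -- the pointwise sandwich condition must fail
  have hfail : ¬ ∀ φ : Set ι, φ ∈ hull (⋃ p ∈ ({a, b} : Finset κ), (↑(esupp (U p)) : Set ι)) (U v) → φ ∉ U v →
      2 ≤ (({a, b} : Finset κ).filter fun p => φ ∉ U p).card :=
    fun h => hns (structured_insert_of_pairwise_disjoint U hU hvP hdP h)
  push Not at hfail
  obtain ⟨χ, hχh, hχU, hlt⟩ := hfail
  -- `χ` lies in the glued frame of `v`: the opened coordinates are outside its support
  have hSdis : Disjoint (⋃ p ∈ ({a, b} : Finset κ), (↑(esupp (U p)) : Set ι)) ↑(esupp (gframe U W v)) := by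
    rw [Set.disjoint_iUnion₂_left]
    intro p hp
    simp only [mem_insert, mem_singleton] at hp
    rcases hp with rfl | rfl
    · rw [← hga]; exact disjoint_coe.2 (hd _ ha v hv hav)
    · rw [← hgb]; exact disjoint_coe.2 (hd _ hb v hv hbv)
  have hχg : χ ∈ gframe U W v :=
    mem_of_union_mem_of_disjoint_esupp (isUpperSet_gframe U W hU v) hSdis (subset_gframe U W hU v hχh)
  have hχN : χ ∈ gann U W v := ⟨hχg, hχU⟩
  -- (F2): `χ` fails two of `a, b, w`; but at most one of `a, b`
  have h2 := two_le_card_gfail' U W hU hne hS hF hE0 hv hχN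
  set S := (W.erase v).filter fun j => χ ∉ gframe U W j with hSdef
  have hSmem : ∀ u ∈ S, u = a ∨ u = b ∨ u = w := by
    intro u hu
    rw [hSdef, mem_filter, mem_erase] at hu
    exact hrest u hu.1.2 hu.1.1
  by_cases hχa : χ ∈ U a
  · -- `a` does not fail, so `b` and `w` fail: type one hosted by `a`, failing `b`
    have haS : a ∉ S := by rw [hSdef, mem_filter, hga]; exact fun h => h.2 hχa
    obtain ⟨hbS, hwS⟩ := mem_and_mem_of_two_le_card h2 hSmem haS
    rw [hSdef, mem_filter] at hbS hwS
    rw [hgb] at hbS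
    exact ⟨χ, Or.inr ⟨hχN, hwS.2, hbS.2, hχa⟩⟩
  · by_cases hχb : χ ∈ U b
    · have hbS : b ∉ S := by rw [hSdef, mem_filter, hgb]; exact fun h => h.2 hχb
      have hSmem' : ∀ u ∈ S, u = b ∨ u = a ∨ u = w := fun u hu => by
        rcases hSmem u hu with h | h | h
        · exact Or.inr (Or.inl h)
        · exact Or.inl h
        · exact Or.inr (Or.inr h)
      obtain ⟨haS, hwS⟩ := mem_and_mem_of_two_le_card h2 hSmem' hbS
      rw [hSdef, mem_filter] at haS hwS
      rw [hga] at haS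
      exact ⟨χ, Or.inl ⟨hχN, hwS.2, haS.2, hχb⟩⟩
    · -- both `a` and `b` fail: contradicts `hlt`
      exfalso
      have : ({a, b} : Finset κ) ⊆ ({a, b} : Finset κ).filter fun p => χ ∉ U p := by
        intro p hp
        rw [mem_filter]; refine ⟨hp, ?_⟩
        simp only [mem_insert, mem_singleton] at hp
        rcases hp with rfl | rfl
        · exact hχa
        · exact hχb
      have hc := card_le_card this
      rw [card_pair hab] at hc
      omega

/-- **Antipodality of type-one points (TIGHTNESS-III 2.6).**  A type-one point `χ` of `v` and a type-one point `ψ` of `w` (any failed/host pures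
among `a, b`) share no coordinate, and every core-free coordinate lies in one of them. [this work] -/
theorem typeOne_antipodal (hU : ∀ k, IsUpperSet (U k)) (hne : ∀ k, (U k).Nonempty) (hS : ∀ h, Structured (faceT U h) W)
    (hF : ∀ f, CoreFree U f → Structured (faceF U f) W ∧ FaceFConsistent U W f)
    {a b v w : κ} (hv : v ∈ W) (hw : w ∈ W)
    (hrestv : ∀ u ∈ W, u ≠ v → u = a ∨ u = b ∨ u = w) (hrestw : ∀ u ∈ W, u ≠ w → u = a ∨ u = b ∨ u = v)
    (hpa : gann U W a = ∅) (hpb : gann U W b = ∅)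
    {p q p' q' : κ} (hpq : (p = a ∧ q = b) ∨ (p = b ∧ q = a)) (hpq' : (p' = a ∧ q' = b) ∨ (p' = b ∧ q' = a))
    {χ ψ : Set ι} (hχ : TypeOne U W v w p q χ) (hψ : TypeOne U W w v p' q' ψ) :
    (∀ h, ¬ (h ∈ χ ∧ h ∈ ψ)) ∧ ∀ f, CoreFree U f → f ∈ χ ∨ f ∈ ψ := by
  have hga : gframe U W a = U a := (gann_eq_empty_iff U W hU a).1 hpa
  have hgb : gframe U W b = U b := (gann_eq_empty_iff U W hU b).1 hpb
  -- failure sets: `χ` fails at most `p` and `w`; `ψ` fails at most `p'` and `v`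
  have hχQ : ∀ u ∈ W, χ ∉ gframe U W u → u = p ∨ u = w := by
    intro u hu hcu
    by_cases huv : u = v
    · subst huv; exact absurd hχ.1.1 hcu
    rcases hrestv u hu huv with rfl | rfl | rfl
    · rcases hpq with ⟨rfl, rfl⟩ | ⟨rfl, rfl⟩
      · exact Or.inl rfl
      · rw [hga] at hcu; exact absurd hχ.2.2.2 hcu
    · rcases hpq with ⟨rfl, rfl⟩ | ⟨rfl, rfl⟩
      · rw [hgb] at hcu; exact absurd hχ.2.2.2 hcu
      · exact Or.inl rfl
    · exact Or.inr rfl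
  have hψQ : ∀ u ∈ W, ψ ∉ gframe U W u → u = p' ∨ u = v := by
    intro u hu hcu
    by_cases huw : u = w
    · subst huw; exact absurd hψ.1.1 hcu
    rcases hrestw u hu huw with rfl | rfl | rfl
    · rcases hpq' with ⟨rfl, rfl⟩ | ⟨rfl, rfl⟩
      · exact Or.inl rfl
      · rw [hga] at hcu; exact absurd hψ.2.2.2 hcu
    · rcases hpq' with ⟨rfl, rfl⟩ | ⟨rfl, rfl⟩
      · rw [hgb] at hcu; exact absurd hψ.2.2.2 hcu
      · exact Or.inl rfl
    · exact Or.inr rfl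
  refine ⟨fun h ⟨hhχ, hhψ⟩ => false_of_cross_gann U W hU hne hS hv hw hχ.1 hψ.1 hχQ hψQ hhχ hhψ, fun f hf => ?_⟩
  by_contra hnot
  rw [not_or] at hnot
  exact false_of_cross_gann_faceF U W hU hf (hF f hf).1 (hF f hf).2 hv hw hχ.1 hψ.1 hχQ hψQ hnot.1 hnot.2

/-- **Trace constancy** (consequence of antipodality): two type-one points of `v` contain the same core-free coordinates, as soon as `w` has a
type-one point. [this work] -/
theorem typeOne_trace_eq (hU : ∀ k, IsUpperSet (U k)) (hne : ∀ k, (U k).Nonempty) (hS : ∀ h, Structured (faceT U h) W)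
    (hF : ∀ f, CoreFree U f → Structured (faceF U f) W ∧ FaceFConsistent U W f)
    {a b v w : κ} (hv : v ∈ W) (hw : w ∈ W)
    (hrestv : ∀ u ∈ W, u ≠ v → u = a ∨ u = b ∨ u = w) (hrestw : ∀ u ∈ W, u ≠ w → u = a ∨ u = b ∨ u = v)
    (hpa : gann U W a = ∅) (hpb : gann U W b = ∅)
    {p q p₁ q₁ p' q' : κ} (hpq : (p = a ∧ q = b) ∨ (p = b ∧ q = a)) (hpq₁ : (p₁ = a ∧ q₁ = b) ∨ (p₁ = b ∧ q₁ = a))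
    (hpq' : (p' = a ∧ q' = b) ∨ (p' = b ∧ q' = a))
    {χ χ₁ ψ : Set ι} (hχ : TypeOne U W v w p q χ) (hχ₁ : TypeOne U W v w p₁ q₁ χ₁) (hψ : TypeOne U W w v p' q' ψ)
    {f : ι} (hf : CoreFree U f) : f ∈ χ ↔ f ∈ χ₁ := by
  have A := typeOne_antipodal U W hU hne hS hF hv hw hrestv hrestw hpa hpb hpq hpq' hχ hψ
  have A₁ := typeOne_antipodal U W hU hne hS hF hv hw hrestv hrestw hpa hpb hpq₁ hpq' hχ₁ hψ
  constructor
  · intro h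
    rcases A₁.2 f hf with h1 | h1
    · exact h1
    · exact absurd ⟨h, h1⟩ (A.1 f)
  · intro h
    rcases A.2 f hf with h1 | h1
    · exact h1
    · exact absurd ⟨h, h1⟩ (A₁.1 f)

/-- **TIGHTNESS-III 2.6 (ii).**  For a type-one point `χ` of `v` (failed pure `p`, host `q`) and a core-free coordinate `f ∈ χ`, the configuration
`χ ∖ {f}` leaves `gframe v ∩ U q` — provided `w` has a type-one point (trace constancy).  Hence `f` lies in the essential support of `gframe v`
or of `U q`. [this work] -/
theorem typeOne_diff_singleton (hU : ∀ k, IsUpperSet (U k)) (hne : ∀ k, (U k).Nonempty) (hS : ∀ h, Structured (faceT U h) W)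
    (hF : ∀ f, CoreFree U f → Structured (faceF U f) W ∧ FaceFConsistent U W f)
    {a b v w : κ} (hv : v ∈ W) (hw : w ∈ W)
    (hrestv : ∀ u ∈ W, u ≠ v → u = a ∨ u = b ∨ u = w) (hrestw : ∀ u ∈ W, u ≠ w → u = a ∨ u = b ∨ u = v)
    (hpa : gann U W a = ∅) (hpb : gann U W b = ∅)
    {p q p' q' : κ} (hpq : (p = a ∧ q = b) ∨ (p = b ∧ q = a)) (hpq' : (p' = a ∧ q' = b) ∨ (p' = b ∧ q' = a))
    {χ ψ : Set ι} (hχ : TypeOne U W v w p q χ) (hψ : TypeOne U W w v p' q' ψ) {f : ι} (hf : CoreFree U f) (hfχ : f ∈ χ) :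
    ¬ (χ \ {f} ∈ gframe U W v ∧ χ \ {f} ∈ U q) := by
  rintro ⟨h1, h2⟩
  -- `χ ∖ {f}` is again a type-one point of `v` with the same data
  have hχ' : TypeOne U W v w p q (χ \ {f}) := by
    refine ⟨⟨h1, fun h => hχ.1.2 (hU v Set.sdiff_subset h)⟩, fun h => hχ.2.1 ?_, fun h => hχ.2.2.1 (hU p Set.sdiff_subset h), h2⟩
    exact isUpperSet_gframe U W hU w Set.sdiff_subset h
  have := (typeOne_trace_eq U W hU hne hS hF hv hw hrestv hrestw hpa hpb hpq hpq hpq' hχ hχ' hψ hf).1 hfχ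
  exact this.2 rfl

/-- Consequence: such an `f` lies in the essential support of `gframe v` or of `U q`. [this work] -/
theorem mem_esupp_or_of_typeOne (hU : ∀ k, IsUpperSet (U k)) (hne : ∀ k, (U k).Nonempty) (hS : ∀ h, Structured (faceT U h) W)
    (hF : ∀ f, CoreFree U f → Structured (faceF U f) W ∧ FaceFConsistent U W f)
    {a b v w : κ} (hv : v ∈ W) (hw : w ∈ W)
    (hrestv : ∀ u ∈ W, u ≠ v → u = a ∨ u = b ∨ u = w) (hrestw : ∀ u ∈ W, u ≠ w → u = a ∨ u = b ∨ u = v)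
    (hpa : gann U W a = ∅) (hpb : gann U W b = ∅)
    {p q p' q' : κ} (hpq : (p = a ∧ q = b) ∨ (p = b ∧ q = a)) (hpq' : (p' = a ∧ q' = b) ∨ (p' = b ∧ q' = a))
    {χ ψ : Set ι} (hχ : TypeOne U W v w p q χ) (hψ : TypeOne U W w v p' q' ψ) {f : ι} (hf : CoreFree U f) (hfχ : f ∈ χ) :
    f ∈ esupp (gframe U W v) ∨ f ∈ esupp (U q) := by
  by_contra hnot
  rw [not_or] at hnot
  apply typeOne_diff_singleton U W hU hne hS hF hv hw hrestv hrestw hpa hpb hpq hpq' hχ hψ hf hfχ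
  exact ⟨diff_singleton_mem_of_not_affects (isUpperSet_gframe U W hU v) (fun h => hnot.1 (mem_esupp.2 h)) hχ.1.1,
    diff_singleton_mem_of_not_affects (hU q) (fun h => hnot.2 (mem_esupp.2 h)) hχ.2.2.2⟩

end Glued

end GluedFrames

end Summit.CriticalPhenomena.PercolationContinuityZ3.Theorems
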